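import Summits.AnomalousDissipation.AnomalousDissipation.Theorems.SawtoothPulseCascadeK3LocalisedClosureApproxEnvelopes
import Literature.Analysis.FunctionSpaces.TorusLinearisedNSForcedExistence
import Literature.Analysis.FunctionSpaces.TorusClassicalNSGluing
import HarnessLib

/-!
# K3loc / ApproxSol58, line `DriftFree` — helper: the classical linearised response EXISTS on every closed window

Helper file of the lead prover (gen 3) for `ApproxSol58` (stmt-AnomalousDissipation-19688; parent crux K3loc
stmt-AnomalousDissipation-19492).  The reductions `approximateSolution_of_window` (p447142) and
`approximateSolution_of_envelopes` (p473374) take a classical solution `(L, q)` on `[0, T'] × 𝕋²` of the Navier–Stokes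
equations linearised at the cascade carrier `ū` with the heat-lag source `νΔū`, from rest.  This file discharges its
EXISTENCE once and for all (`exists_linearisedResponse`): the tree's `Torus.linearisedNSForced_exists`
(Constantin–Foias Ch. 14 / Temam Ch. VI: smooth solutions of the inhomogeneous linearised problem on a compact window)
applies along the carrier — jointly smooth on `[0,1) ⊃ [0,T']` (`cascadeFieldSmooth`) with divergence-free slices — with
the source `νΔū`, which is jointly smooth (`IsSmoothSpaceTimeOn.laplacian`) and has mean-zero slices (`∫Δ = 0`), and the
zero datum.  So every `∀ (L, q), response → …` stub of the crux is non-vacuous and every `∃ (L, q)` stub reduces to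
estimates.
-/

-- `Summit.<Summit>.<Problem>`: single-conjunct summit, the duplicate namespace segment is deliberate.
set_option linter.dupNamespace false

noncomputable section

namespace Summit.AnomalousDissipation.AnomalousDissipation.Theorems.SawtoothPulseCascade.DriftFreeApprox

open MeasureTheory Set
open Literature.Analysis Literature.Analysis.FunctionSpaces Literature.Analysis.FluidPDE
open Literature.Analysis.FluidPDE.SawtoothCascade
open Literature.Analysis.FluidPDE.SawtoothCascade.DriftFree

/-- The heat-lag source `νΔū` has mean-zero slices on `[0,1)`. [folklore] -/
theorem hasZeroMean_laplacian_field (P : CascadeParams) (hδ₀ : 0 < P.δ₀) (hd : 0 < P.d) (ν : ℝ) {t : ℝ}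
    (ht : t ∈ Ico (0 : ℝ) 1) :
    FunctionSpaces.Torus.HasZeroMean (fun x => ν • FunctionSpaces.Torus.laplacian (P.field t) x) := by
  unfold FunctionSpaces.Torus.HasZeroMean
  rw [integral_smul, FunctionSpaces.Torus.integral_laplacian_eq_zero_of_isSmooth
    ((cascadeFieldSmooth P hδ₀ hd).isSmooth_slice ht), smul_zero]

/-- **The classical linearised response exists on closed windows.**  For `ν > 0` and `0 < T' < 1` there are `L`, `q`
jointly smooth on `[0, T'] × 𝕋²` with `div L = 0`, `L(0) = 0` and
`∂ₜL + (ū·∇)L + (L·∇)ū = νΔL − ∇q + νΔū` pointwise on `[0, T']` (one-sided time derivative within `[0, T']`).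
[folklore] -/
theorem exists_linearisedResponse (P : CascadeParams) (hδ₀ : 0 < P.δ₀) (hd : 0 < P.d) {ν T' : ℝ} (hν : 0 < ν)
    (hT'0 : 0 < T') (hT'1 : T' < 1) :
    ∃ (L : ℝ → UnitAddTorus (Fin 2) → EuclideanSpace ℝ (Fin 2)) (q : ℝ → UnitAddTorus (Fin 2) → ℝ),
      FunctionSpaces.Torus.IsSmoothSpaceTimeOn (Icc 0 T') L ∧
      FunctionSpaces.Torus.IsSmoothSpaceTimeOn (Icc 0 T') q ∧
      (∀ t ∈ Icc 0 T', FunctionSpaces.Torus.IsDivFree (L t)) ∧ L 0 = 0 ∧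
      (∀ t ∈ Icc 0 T', ∀ x,
        FunctionSpaces.Torus.timeDerivWithin (Icc 0 T') L t x +
            FunctionSpaces.Torus.convect (P.field t) (L t) x + FunctionSpaces.Torus.convect (L t) (P.field t) x =
          ν • FunctionSpaces.Torus.laplacian (L t) x - FunctionSpaces.Torus.gradient (q t) x +
            ν • FunctionSpaces.Torus.laplacian (P.field t) x) := by
  have hfs : CascadeFieldSmooth P := cascadeFieldSmooth P hδ₀ hd
  have hI : Icc 0 T' ⊆ Ico (0 : ℝ) 1 := fun s hs => ⟨hs.1, hs.2.trans_lt hT'1⟩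
  have hu : FunctionSpaces.Torus.IsSmoothSpaceTimeOn (Icc 0 T') P.field := hfs.mono hI
  have hU : UniqueDiffOn ℝ (Icc 0 T') := uniqueDiffOn_Icc hT'0
  have hg : FunctionSpaces.Torus.IsSmoothSpaceTimeOn (Icc 0 T')
      (fun t x => ν • FunctionSpaces.Torus.laplacian (P.field t) x) := (hu.laplacian hU).const_smul ν
  have h0s : FunctionSpaces.Torus.IsSmooth (fun _ : UnitAddTorus (Fin 2) => (0 : EuclideanSpace ℝ (Fin 2))) :=
    FunctionSpaces.Torus.isSmooth_const _
  have h0d : FunctionSpaces.Torus.IsDivFree (fun _ : UnitAddTorus (Fin 2) => (0 : EuclideanSpace ℝ (Fin 2))) :=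
    fun x => FluidPDE.Torus.divergence_zero x
  have h0m : FunctionSpaces.Torus.HasZeroMean (fun _ : UnitAddTorus (Fin 2) => (0 : EuclideanSpace ℝ (Fin 2))) := by
    unfold FunctionSpaces.Torus.HasZeroMean; simp
  obtain ⟨w, q, hw, hq, hdiv, -, -, heq, h0⟩ :=
    FunctionSpaces.Torus.linearisedNSForced_exists hν hT'0 hu (fun t ht => DriftFreeExistence.isDivFree_field P (hI ht))
      hg (fun t ht => hasZeroMean_laplacian_field P hδ₀ hd ν (hI ht)) h0s h0d h0m
  exact ⟨w, q, hw, hq, hdiv, h0, fun t ht x => heq t ht x⟩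

/-- **The ∃-form of a response estimate from its ∀-form.**  Any property `R` holding for EVERY classical response on
`[0, T']` holds for SOME response (the class is non-empty): the pattern turning `∀ (L, q)`-stubs into the `∃ (L, q)`
packages of `approximateSolution_of_window` / `_of_envelopes`. [folklore] -/
theorem exists_response_of_forall (P : CascadeParams) (hδ₀ : 0 < P.δ₀) (hd : 0 < P.d) {ν T' : ℝ} (hν : 0 < ν)
    (hT'0 : 0 < T') (hT'1 : T' < 1)
    {R : (ℝ → UnitAddTorus (Fin 2) → EuclideanSpace ℝ (Fin 2)) → (ℝ → UnitAddTorus (Fin 2) → ℝ) → Prop}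
    (h : ∀ (L : ℝ → UnitAddTorus (Fin 2) → EuclideanSpace ℝ (Fin 2)) (q : ℝ → UnitAddTorus (Fin 2) → ℝ),
      FunctionSpaces.Torus.IsSmoothSpaceTimeOn (Icc 0 T') L →
      FunctionSpaces.Torus.IsSmoothSpaceTimeOn (Icc 0 T') q →
      (∀ t ∈ Icc 0 T', FunctionSpaces.Torus.IsDivFree (L t)) → L 0 = 0 →
      (∀ t ∈ Icc 0 T', ∀ x,
        FunctionSpaces.Torus.timeDerivWithin (Icc 0 T') L t x +
            FunctionSpaces.Torus.convect (P.field t) (L t) x + FunctionSpaces.Torus.convect (L t) (P.field t) x =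
          ν • FunctionSpaces.Torus.laplacian (L t) x - FunctionSpaces.Torus.gradient (q t) x +
            ν • FunctionSpaces.Torus.laplacian (P.field t) x) → R L q) :
    ∃ (L : ℝ → UnitAddTorus (Fin 2) → EuclideanSpace ℝ (Fin 2)) (q : ℝ → UnitAddTorus (Fin 2) → ℝ),
      FunctionSpaces.Torus.IsSmoothSpaceTimeOn (Icc 0 T') L ∧
      FunctionSpaces.Torus.IsSmoothSpaceTimeOn (Icc 0 T') q ∧
      (∀ t ∈ Icc 0 T', FunctionSpaces.Torus.IsDivFree (L t)) ∧ L 0 = 0 ∧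
      (∀ t ∈ Icc 0 T', ∀ x,
        FunctionSpaces.Torus.timeDerivWithin (Icc 0 T') L t x +
            FunctionSpaces.Torus.convect (P.field t) (L t) x + FunctionSpaces.Torus.convect (L t) (P.field t) x =
          ν • FunctionSpaces.Torus.laplacian (L t) x - FunctionSpaces.Torus.gradient (q t) x +
            ν • FunctionSpaces.Torus.laplacian (P.field t) x) ∧ R L q := by
  obtain ⟨L, q, hL, hq, hdiv, hL0, hlin⟩ := exists_linearisedResponse P hδ₀ hd hν hT'0 hT'1
  exact ⟨L, q, hL, hq, hdiv, hL0, hlin, h L q hL hq hdiv hL0 hlin⟩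

end Summit.AnomalousDissipation.AnomalousDissipation.Theorems.SawtoothPulseCascade.DriftFreeApprox

end
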